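import Literature.NumberTheory.Automorphic.LanglandsShelstad1987.Defs
import Literature.NumberTheory.Rogawski1990.LocalTransfer
import Mathlib.LinearAlgebra.Matrix.SpecialLinearGroup
import Mathlib.RingTheory.Norm.Defs
import HarnessLib

/-!
# Langlands–Shelstad (1987) §1 «Preliminaries»: (1.1) An example — Lemma [L-L]; (1.2) Notation; (1.3) Point
# correspondences — Lemma 1.3.A and the image correspondence (i), (ii); (1.4) Transfer factors — the axioms a factor
# must satisfy (Math. Ann. 278, pp. 221–228; IAS typescript pp. 3–10), as NAMED FACTS and a CENSUS against the tree

Topic `Literature/NumberTheory/Automorphic/LanglandsShelstad1987/`; namespace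
`Literature.NumberTheory.Automorphic.LanglandsShelstad1987.Preliminaries` (carpet squad TN, SPLIT-v1 row TN-t01).
Statements only: every `def` below is either a predicate ON explicitly given data (COORDINATION NOTE 1 (b): consumers
instantiate with their data; nothing is claimed for all data over bare-function carriers) or a census pointer; no
theorem, no `sorry`, no `axiom`, no `instance`, no `notation`.  Page pins «(p. N)» are Math. Ann. 278 pages read on the
GDZ scan (`HOME/lit/lit3/g0/texts/LanglandsShelstad1987-GDZ/`, concordance `CONCORDANCE-LS1987.md`); «typescript p. N»
is the IAS reissue `paper:doi-10-1007-bf01458070`.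

## CENSUS of §1 (item ↦ decl ↦ page)

(1.1) An example (`G = SL₂`, `H` the norm-one torus of the quadratic `E/F`), pp. 221–224 / typescript pp. 3–6:
* the five terms (I) `⟨λ(T), s_T⟩`, (II) `χ_α((α(γ_T) − 1)/a_α)`, (III₁) `⟨inv(γ_H, γ), s_T⟩⁻¹`, (III₂) `⟨a, γ_T⟩`,
  (IV) `|(α(γ_T) − 1)(α(γ_T)⁻¹ − 1)|_F^{1/2}` and `Δ = Δ(γ̄_H, γ̄)·Δ₀(γ_H, γ)/Δ₀(γ̄_H, γ̄)` (1.1.1) ↦ NOT TYPED here: they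
  are the `SL₂` case of the general terms `Δ_I, Δ_II, Δ_III₁, Δ_III₂, Δ_IV` of §3 (TN-t02 `TransferFactorDefinition.lean`)
  and need Tate–Nakayama pairings ∕ `H¹(W, T̂)` (no Mathlib notion);
* **Lemma [L-L]** («Lemma 1.1.A» of the split), p. 224 / typescript p. 6 ↦ `Lemma_1_1_A` — predicate on a given factor
  `Δ` for `SL₂(F)` and `H(F) = ker(Nm_{E/F}) ≤ E^×` (concrete Mathlib groups), with the test-function classes and the
  orbital measures as parameters (the tree currency ★ `TransferFactorData`, ★ `classOrbitalIntegral`).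
(1.2) Notation, pp. 224–225 / typescript pp. 6–7:
* `F`, `Γ`, `W_F`, `G`, quasi-split inner form `(G*, ψ)`, based root data `Ψ(G)`, `ᴸG = Ĝ ⋊ W_F` ↦ the tree's ★
  `Literature.NumberTheory.Automorphic.LGroupData` (Galois form) is the carrier; `Ψ(G)`, `ψ` NOT TYPED (no reductive
  `F`-groups in Mathlib);
* endoscopic data `(H, ℋ, s, ξ)` (i)–(iv) and their equivalence ↦ ★ `…LanglandsShelstad1987.EndoscopicDatum`,
  `EndoscopicDatum.centralizerImage`, `EndoscopicDatum.IsLEquiv` (sibling `Defs.lean`, with the stated omissions).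
(1.3) Point correspondences, pp. 225–226 / typescript pp. 8–9:
* `A_{H/G}`, `G`-regular, strongly `G`-regular, stable conjugacy, «image» ↦ interface ★ `PointCorrespondence` +
  `IsGRegular`, `IsStronglyGRegular`, `IsGammaMap` (`Defs.lean`);
* **Lemma 1.3.A** «`A_{H/G}` is a `Γ`-map» (p. 225) ↦ `Lemma_1_3_A`;
* «A strongly `G`-regular element is strongly regular» (p. 225) ↦ `Par_1_3_stronglyGRegular_stronglyRegular`;
* «For strongly regular elements … stable conjugacy is the same as conjugacy under `G(F̄)` or `H(F̄)`» (p. 225) ↦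
  `Par_1_3_stConj_iff_of_stronglyRegular`;
* definition of «`γ_H` is an image of `γ_G`» for strongly `G`-regular `γ_H` via `A_{H/G}` (p. 226) ↦
  `Par_1_3_isImage_iff_of_stronglyGRegular`;
* (i), (ii) of p. 226 ↦ `Par_1_3_image_i`, `Par_1_3_image_ii`, `Par_1_3_image_ii_finite` (the «If `F` is local»
  clause);
* admissible embeddings `T_H → T_{G*}`, `A(T_{G*}) = {g : gσ(g⁻¹) ∈ T_{G*}}`, independence of the admissible embedding
  ↦ NOT TYPED (maximal tori ∕ Borel pairs over `F̄`; no Mathlib notion) — their output is the relation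
  `PointCorrespondence.IsImage`.
(1.4) Transfer factors (F local), pp. 226–228 / typescript pp. 9–10:
* Haar measures `|ω|` from invariant top forms via Hilbert 90 ↦ NOT TYPED (no invariant differential forms on
  `F`-groups); the orbital measures are the PARAMETER ★ `Literature.NumberTheory.Automorphic.OrbitalMeasureFamily`;
* `Φ(γ, f)` ↦ ★ `Literature.NumberTheory.Automorphic.classOrbitalIntegral`; `Φ^st(γ_H, f^H)` ↦ ★
  `Literature.NumberTheory.Rogawski1990.stableOrbitalIntegralRel`;
* the axioms on `Δ`: (i) «depends only on the conjugacy class of `γ` in `G(F)` and the stable conjugacy class of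
  `γ_H` in `H(F)`» ↦ ★ `…LanglandsShelstad1987.Properties.Lemma41CClassInvariance` (TN-t03; the same sentence) and
  ★ `Rogawski1990.TransferFactorData.conj_left/conj_right`; (ii) «`Δ(γ_H, γ) = 0` unless `γ_H` is an image of `γ`» ↦
  ★ `Rogawski1990.TransferFactorData.eq_zero_of_not_rel`; «`Δ`-matching orbital integrals» ↦ ★
  `Rogawski1990.IsDeltaTransferRel`; «We call `Δ` a transfer factor if for each `f` … there exists `f^H` … with
  `Δ`-matching orbital integrals» ↦ ★ `Rogawski1990.IsDeltaTransferExistsRel`; «It is best to demand that `Δ(γ_H, γ)`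
  be nonzero if `γ_H` is an image of `γ`» ↦ ★ `Rogawski1990.TransferFactorData.IsNondegenerate` — CITED, not restated.

## References
* [LanglandsShelstad1987] R. P. Langlands, D. Shelstad, *On the definition of transfer factors*, Math. Ann. 278
  (1987) 219–271, §1 pp. 221–228 (GDZ scan; IAS typescript pp. 3–10 = `paper:doi-10-1007-bf01458070`).
* [LabesseLanglands1979] J.-P. Labesse, R. P. Langlands, *L-indistinguishability for SL(2)*, Canad. J. Math. 31
  (1979) — print's [L-L], the source of Lemma [L-L].
-/

noncomputable section

namespace Literature.NumberTheory.Automorphic.LanglandsShelstad1987.Preliminaries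

open Literature.NumberTheory.Automorphic
open Literature.NumberTheory.Automorphic.LanglandsShelstad1987
open Literature.NumberTheory.Rogawski1990

universe u v w

/-! ## (1.1) An example: `G = SL₂`, `H(F) = ker Nm_{E/F}` (pp. 221–224) -/

section Example

variable (F : Type u) [Field F] (E : Type v) [Field E] [Algebra F E]

/-- `H(F)` for the torus `H` of (1.1): «`H` to be a one-dimensional torus split over the quadratic extension `E` of `F`
and anisotropic over `F`» (p. 221), so `H(F) = {x ∈ E^× : Nm_{E/F} x = 1}`, as a subgroup of `E^×` (Mathlib
`Algebra.norm`). [cite: LanglandsShelstad1987, §1.1 (p. 221)] -/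
def normOneTorus : Subgroup Eˣ := (Units.map (Algebra.norm F : E →* F)).ker

/-- The image relation of (1.1) (pp. 221–222): «To `γ_H ∈ H(E)` we attach the conjugacy class in `G(E)` consisting of
semisimple elements with eigenvalues `γ_H^{±1}`. Assume that `γ_H ≠ ±1` lies in `H(F)`. Then the associated class
meets `SL₂(F)` in a stable conjugacy class of regular semisimple elements. Call `γ_H` an image of any `γ` in this
stable class» — for `γ ∈ SL₂(F)` (`det γ = 1`) «eigenvalues `γ_H^{±1}`» is `tr γ = γ_H + γ_H⁻¹` in `E`.
[cite: LanglandsShelstad1987, §1.1 (pp. 221–222)] -/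
def IsImageSL2 (γH : normOneTorus F E) (γ : Matrix.SpecialLinearGroup (Fin 2) F) : Prop :=
  ((γH : Eˣ) : E) ≠ 1 ∧ ((γH : Eˣ) : E) ≠ -1 ∧
    algebraMap F E (Matrix.trace (γ : Matrix (Fin 2) (Fin 2) F)) = ((γH : Eˣ) : E) + ((γH⁻¹ : Eˣ) : E)

/-- **Lemma [L-L]** («Lemma 1.1.A» of the squad split; p. 224 / typescript p. 6), for `G = SL₂` over the local field
`F` of characteristic zero, `H(F) = ker Nm_{E/F}`, and THE factor `Δ` of (1.1.1) (canonical up to the constant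
`Δ(γ̄_H, γ̄)`, built from the terms (I)–(IV)): «For `f ∈ C_c^∞(G(F))` the function
`f^H : γ_H → Σ_γ Δ(γ_H, γ)Φ(γ, f)` extends smoothly to `H(F)`» (the sum over representatives `γ` of the regular
semisimple conjugacy classes of `G(F)`; «`Δ(γ_H, γ)` is to be zero unless `γ_H` is an image of `γ`, so that the sum
contains at most two non-zero terms», p. 222).  TYPED as a predicate on GIVEN data — the factor `T` (tree currency ★
`TransferFactorData`, supported on `IsImageSL2`), the orbital measures `mG` («the `G`-invariant measure prescribed by
a choice of invariant forms of highest degree», p. 222) and the two function classes `CcInfG = C_c^∞(SL₂(F))`,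
`SmoothH` = smooth functions on `H(F)` (topologies ∕ smooth structures of `F`-groups are not in Mathlib): every
`f ∈ CcInfG` has an `f^H ∈ SmoothH` agreeing with `Σ_{[γ]} Δ(γ_H, γ)Φ([γ], f)` at every `γ_H ≠ ±1`.  The terms
(I)–(IV) themselves are not constructed here (census). [cite: LanglandsShelstad1987, §1.1 Lemma [L-L] (p. 224)] -/
def Lemma_1_1_A
    [∀ γ : Matrix.SpecialLinearGroup (Fin 2) F,
      MeasurableSpace (Matrix.SpecialLinearGroup (Fin 2) F ⧸ Subgroup.centralizer ({γ} : Set _))]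
    (T : TransferFactorData (normOneTorus F E) (Matrix.SpecialLinearGroup (Fin 2) F) (IsImageSL2 F E))
    (mG : OrbitalMeasureFamily (Matrix.SpecialLinearGroup (Fin 2) F))
    (CcInfG : (Matrix.SpecialLinearGroup (Fin 2) F → ℂ) → Prop) (SmoothH : (normOneTorus F E → ℂ) → Prop) : Prop :=
  ∀ f : Matrix.SpecialLinearGroup (Fin 2) F → ℂ, CcInfG f →
    ∃ fH : normOneTorus F E → ℂ, SmoothH fH ∧
      ∀ γH : normOneTorus F E, ((γH : Eˣ) : E) ≠ 1 → ((γH : Eˣ) : E) ≠ -1 →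
        fH γH = ∑ᶠ c : ConjClasses (Matrix.SpecialLinearGroup (Fin 2) F),
          T.Δ γH (Quotient.out c) * classOrbitalIntegral mG f c

end Example

/-! ## (1.3) Point correspondences (pp. 225–226): statements on a given `PointCorrespondence` -/

section Points

variable {Γ : Type u} {HF : Type v} {GF : Type w} [Group Γ] [Group HF] [Group GF]
variable (P : PointCorrespondence Γ HF GF)

/-- **Lemma 1.3.A** (p. 225 / typescript p. 8): «`A_{H/G}` is a `Γ`-map» — for the given interface `P`, the map
`P.AHG : Cℓ_ss(H(F̄)) → Cℓ_ss(G(F̄))` commutes with the two `Γ`-actions (spelled out; definitionally the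
predicate `P.IsGammaMap` of `Defs`). [cite: LanglandsShelstad1987, Lemma 1.3.A (p. 225)] -/
def Lemma_1_3_A : Prop := ∀ (σ : Γ) (c : P.CH), P.AHG (P.galH σ c) = P.galG σ (P.AHG c)

/-- (1.3), p. 225: «A strongly `G`-regular element is strongly regular» (in `H`).
[cite: LanglandsShelstad1987, §1.3 (p. 225)] -/
def Par_1_3_stronglyGRegular_stronglyRegular : Prop :=
  ∀ γH : HF, P.IsStronglyGRegular γH → P.IsStronglyRegularH γH

/-- (1.3), p. 225: «For strongly regular elements in `G(F)` or `H(F)` stable conjugacy is the same as conjugacy under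
`G(F̄)` or `H(F̄)`» — on strongly regular elements the stable class is the fibre of the class map to `Cℓ_ss(G(F̄))`,
resp. `Cℓ_ss(H(F̄))`. [cite: LanglandsShelstad1987, §1.3 (p. 225)] -/
def Par_1_3_stConj_iff_of_stronglyRegular : Prop :=
  (∀ γ γ' : GF, P.IsStronglyRegularG γ → (P.stConjG γ γ' ↔ P.classG γ = P.classG γ')) ∧
    ∀ γH γH' : HF, P.IsStronglyRegularH γH → (P.stConjH γH γH' ↔ P.classH γH = P.classH γH')

/-- (1.3), p. 226 / typescript p. 9, the DEFINITION of the correspondence on strongly regular elements: «We call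
strongly `G`-regular `γ_H ∈ H(F)` an image of `γ_G ∈ G(F)` if `γ_G` lies in the image under `A_{H/G}` of the
conjugacy class of `γ_H` in `H(F̄)`» — recorded as the constraint tying `P.IsImage` to `P.AHG` on strongly
`G`-regular `γ_H`. [cite: LanglandsShelstad1987, §1.3 (p. 226)] -/
def Par_1_3_isImage_iff_of_stronglyGRegular : Prop :=
  ∀ (γH : HF) (γ : GF), P.IsStronglyGRegular γH → (P.IsImage γH γ ↔ P.AHG (P.classH γH) = P.classG γ)

/-- (1.3) (i), p. 226 / typescript p. 9: «a `G`-regular semisimple element of `H(F)` is either the image of no element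
or the image of exactly one stable conjugacy class of regular semisimple elements in `G(F)`» — the `γ` of which
`γ_H` is an image are regular semisimple and form at most one stable class. [cite: LanglandsShelstad1987, §1.3 (i) (p. 226)] -/
def Par_1_3_image_i : Prop :=
  ∀ γH : HF, P.IsGRegular γH →
    (∀ γ : GF, P.IsImage γH γ → P.IsRegularG γ) ∧
      ∀ γ γ' : GF, P.IsImage γH γ → (P.IsImage γH γ' ↔ P.stConjG γ γ')

/-- (1.3) (ii), p. 226 / typescript p. 9: «the images of a regular semisimple element in `G(F)` form a union, possibly
empty, of stable conjugacy classes of `G`-regular semisimple elements in `H(F)`». [cite: LanglandsShelstad1987, §1.3 (ii) (p. 226)] -/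
def Par_1_3_image_ii : Prop :=
  ∀ γ : GF, P.IsRegularG γ →
    (∀ γH : HF, P.IsImage γH γ → P.IsGRegular γH) ∧
      ∀ γH γH' : HF, P.IsImage γH γ → P.stConjH γH γH' → P.IsImage γH' γ

/-- (1.3) (ii), last clause, p. 226 / typescript p. 9: «If `F` is local then the union is finite» — for `F` local, the
images of a regular semisimple `γ ∈ G(F)` lie in finitely many stable conjugacy classes of `H(F)` (a consumer asserts
this for local `F` only). [cite: LanglandsShelstad1987, §1.3 (ii) (p. 226)] -/
def Par_1_3_image_ii_finite : Prop :=
  ∀ γ : GF, P.IsRegularG γ → ∃ S : Finset HF, ∀ γH : HF, P.IsImage γH γ → ∃ γ₀ ∈ S, P.stConjH γ₀ γH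

end Points

end Literature.NumberTheory.Automorphic.LanglandsShelstad1987.Preliminaries

end
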